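import Summits.Ventures.LatticeQCDFlow.Exactness.SplittingIntegrator
import Summits.Ventures.LatticeQCDFlow.Scoring.FreeFieldLeapfrog
import HarnessLib

/-!
# Row 2's qpq leapfrog IS row 9's `leapfrog` permutation: the HMC proposal map is a measure-preserving involution

HONEST FRAMING: exact (Metropolis-corrected) sampling algorithms for lattice gauge theory;
figures of merit are autocorrelation/cost numbers at stated couplings and volumes; no
continuum-physics claim.  (SCALAR calibration rung S0-A: not a gauge result.)

Venture `LatticeQCDFlow` (cell pub-lqcd), topic `Exactness`; FANOUT row 2 (`s0-phi4`: the HMC arm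
of the 2D φ⁴ calibration, `latflow.core` qpq leapfrog).  NEW WORK of the cell over Mathlib;
nothing is cited as a fact.  Printed counterparts, named only: Duane–Kennedy–Pendleton–Roweth
1987, Lüscher 2010 §6 (leapfrog ∘ flip is a volume-preserving involution).

Relation to the tree.  `Exactness/SplittingIntegrator.lean` (row 9) types `flip`, `kick`,
`drift`, `leapfrog d g = drift d * kick g * drift d` as permutations of an abstract phase space
`Q × P` and proves time-reversibility (`IsFlipReversible`, `.involutive`) and Liouville
(`measurePreserving_leapfrog`, `measurePreserving_flip`).  `Scoring/FreeFieldLeapfrog.lean` (row 2)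
defines the engine's CONCRETE step `leapfrogQPQ J λ δ` on `(Λ → ℝ) × (Λ → ℝ)` by the formulas
the code runs (`lfDrift`, `lfKick` with the φ⁴ force `latticePhi4Force J λ`).  This file
identifies the two, so that row 9's theorems apply to row 2's integrator verbatim.

## What is proved (any finite site set `Λ`, any real `J`, `λ`, `δ`, any `N`)

* `momFlip (φ, p) = (φ, −p)`; **`hmcProposal J λ δ N = momFlip ∘ (leapfrogQPQ J λ δ)^[N]`** — the
  HMC proposal map (trajectory, then flip); `halfDrift δ = (δ/2)•id`, `kickIncrement = −δ F`;
  `lfDrift_eq_add_smul`, `lfKick_eq_add_kickIncrement` (the sub-steps in vector form).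
* **`leapfrogQPQ_eq_leapfrog`** — `leapfrogQPQ J λ δ = ⇑(leapfrog (addDrift (halfDrift δ)) (kickIncrement J λ δ))`;
  **`hmcProposal_eq_perm`** — `hmcProposal J λ δ N = ⇑(flip * leapfrog _ _ ^ N)`.
* Consequences, hypothesis-free: **`hmcProposal_involutive`** (an involution),
  `measurable_hmcProposal`, `isNegInvariant_volume_pi` (Lebesgue measure on `ℝ^Λ` is symmetric),
  and **`measurePreserving_hmcProposal`** — the proposal map preserves Lebesgue measure
  `volume ⊗ volume` on phase space (discrete Liouville).  These are exactly the two hypotheses of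
  the HMC skeleton (`InvolutiveMetropolis.involMH_invariant`); `Exactness/Phi4HMCExact.lean`
  cashes them into the exactness of the HMC update for interacting φ⁴.

NOT CLAIMED: the pqp variant (same argument with `IsFlipReversible.palindrome`, roles exchanged);
floating-point reversibility of the implementation.
-/

namespace Summit.Ventures.LatticeQCDFlow.Exactness

open Real MeasureTheory Finset
open Summit.Ventures.LatticeQCDFlow.Scoring

/-! ## §2 Row 2's leapfrog is row 9's permutation: the HMC proposal map -/

section Proposal

variable {Λ : Type*} [Fintype Λ]

/-- The momentum flip on row 2's phase space `(Λ → ℝ) × (Λ → ℝ)`. -/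
def momFlip (z : (Λ → ℝ) × (Λ → ℝ)) : (Λ → ℝ) × (Λ → ℝ) := (z.1, -z.2)

/-- **The HMC proposal map**: `N` qpq leapfrog steps of size `δ` (`leapfrogQPQ J λ δ`, the
engine's primary integrator) followed by the momentum flip. -/
noncomputable def hmcProposal (J : Λ → Λ → ℝ) (lam δ : ℝ) (N : ℕ)
    (z : (Λ → ℝ) × (Λ → ℝ)) : (Λ → ℝ) × (Λ → ℝ) :=
  momFlip ((leapfrogQPQ J lam δ)^[N] z)

/-- The half-drift homomorphism `p ↦ (δ/2) p` of the qpq step. -/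
noncomputable def halfDrift (δ : ℝ) : (Λ → ℝ) →+ (Λ → ℝ) :=
  DistribSMul.toAddMonoidHom (Λ → ℝ) (δ / 2)

/-- The kick increment `g(φ) = −δ F(φ)` of the qpq step (`F = ∂S/∂φ = latticePhi4Force J λ`). -/
noncomputable def kickIncrement (J : Λ → Λ → ℝ) (lam δ : ℝ) (φ : Λ → ℝ) : Λ → ℝ :=
  fun x => -(δ * latticePhi4Force J lam φ x)

omit [Fintype Λ] in
/-- The drift sub-step in vector form: `lfDrift τ φ p = φ + τ • p`. -/
theorem lfDrift_eq_add_smul (τ : ℝ) (φ p : Λ → ℝ) : lfDrift τ φ p = φ + τ • p := by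
  funext x
  simp [lfDrift, smul_eq_mul]

/-- The kick sub-step in vector form: `lfKick J λ δ φ p = p + g(φ)`. -/
theorem lfKick_eq_add_kickIncrement (J : Λ → Λ → ℝ) (lam δ : ℝ) (φ p : Λ → ℝ) :
    lfKick J lam δ φ p = p + kickIncrement J lam δ φ := by
  funext x
  simp only [lfKick, kickIncrement, Pi.add_apply]
  ring

/-- **Row 2's qpq step is row 9's `leapfrog` permutation** with the flat half-drift
`q ↦ q + (δ/2) p` and the kick increment `−δ F`. -/
theorem leapfrogQPQ_eq_leapfrog (J : Λ → Λ → ℝ) (lam δ : ℝ) :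
    leapfrogQPQ J lam δ = ⇑(leapfrog (addDrift (halfDrift (Λ := Λ) δ)) (kickIncrement J lam δ)) := by
  funext z
  rw [leapfrog, Equiv.Perm.coe_mul, Equiv.Perm.coe_mul, Function.comp_apply, Function.comp_apply]
  simp only [leapfrogQPQ, lfDrift_eq_add_smul, lfKick_eq_add_kickIncrement]
  rfl

/-- Hence the HMC proposal map is the permutation `flip * leapfrog _ _ ^ N` of row 9. -/
theorem hmcProposal_eq_perm (J : Λ → Λ → ℝ) (lam δ : ℝ) (N : ℕ) :
    hmcProposal J lam δ N
      = ⇑((flip : Equiv.Perm ((Λ → ℝ) × (Λ → ℝ)))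
          * leapfrog (addDrift (halfDrift (Λ := Λ) δ)) (kickIncrement J lam δ) ^ N) := by
  funext z
  rw [Equiv.Perm.coe_mul, Equiv.Perm.coe_pow, Function.comp_apply, ← leapfrogQPQ_eq_leapfrog]
  rfl

/-- **The HMC proposal map is an involution** — every `J`, `λ`, `δ`, `N`. -/
theorem hmcProposal_involutive (J : Λ → Λ → ℝ) (lam δ : ℝ) (N : ℕ) :
    Function.Involutive (hmcProposal J lam δ N) := by
  rw [hmcProposal_eq_perm]
  exact (leapfrog_pow_isFlipReversible (addDrift_reversal _) _ N).involutive

/-- The force field `φ ↦ F(φ)` is measurable (it is continuous). -/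
theorem measurable_latticePhi4Force_field (J : Λ → Λ → ℝ) (lam : ℝ) :
    Measurable (fun φ : Λ → ℝ => latticePhi4Force J lam φ) := by
  refine measurable_pi_lambda _ fun x => ?_
  unfold latticePhi4Force
  fun_prop

/-- The kick increment is measurable. -/
theorem measurable_kickIncrement (J : Λ → Λ → ℝ) (lam δ : ℝ) :
    Measurable (kickIncrement J lam δ) := by
  refine measurable_pi_lambda _ fun x => ?_
  unfold kickIncrement latticePhi4Force
  fun_prop

omit [Fintype Λ] in
/-- The half-drift homomorphism is measurable. -/
theorem measurable_halfDrift (δ : ℝ) : Measurable (halfDrift (Λ := Λ) δ) := by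
  change Measurable fun p : Λ → ℝ => (δ / 2) • p
  exact measurable_id.const_smul (δ / 2)

/-- The HMC proposal map is measurable. -/
theorem measurable_hmcProposal (J : Λ → Λ → ℝ) (lam δ : ℝ) (N : ℕ) :
    Measurable (hmcProposal J lam δ N) := by
  rw [hmcProposal_eq_perm]
  exact measurable_flip_leapfrog_pow (measurable_addDrift (measurable_halfDrift δ))
    (measurable_kickIncrement J lam δ) N

/-- Lebesgue measure on `ℝ^Λ` is symmetric under `p ↦ −p`. -/
theorem isNegInvariant_volume_pi : (volume : Measure (Λ → ℝ)).IsNegInvariant :=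
  haveI : (volume : Measure (Λ → ℝ)).Regular :=
    Measure.Regular.of_sigmaCompactSpace_of_isLocallyFiniteMeasure _
  Measure.IsAddHaarMeasure.isNegInvariant_of_regular _

/-- **The HMC proposal map preserves Lebesgue measure on phase space** (Liouville for the
discrete trajectory: two shears per sub-step, and the flip) — every `J`, `λ`, `δ`, `N`. -/
theorem measurePreserving_hmcProposal (J : Λ → Λ → ℝ) (lam δ : ℝ) (N : ℕ) :
    MeasurePreserving (hmcProposal J lam δ N)
      ((volume : Measure (Λ → ℝ)).prod volume) ((volume : Measure (Λ → ℝ)).prod volume) := by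
  haveI := isNegInvariant_volume_pi (Λ := Λ)
  rw [hmcProposal_eq_perm, Equiv.Perm.coe_mul]
  exact measurePreserving_flip.comp (measurePreserving_perm_pow
    (measurePreserving_leapfrog (measurable_addDrift (measurable_halfDrift δ))
      (measurePreserving_addDrift _) (measurable_kickIncrement J lam δ)) N)

end Proposal

end Summit.Ventures.LatticeQCDFlow.Exactness
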